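import Mathlib
import Summits.Ventures.PercRepro2.RootBridgeTheorem

/-!
# The root-bridge class of row 2′TRI, IV: the vanishing placements and the same-side theorem
(blind cell PercRepro2, p3 g0, 2026-08-25; `proofs/P3-BRIDGE.md` §2, sub-claim S2.b)

With `o, b` on `a₁`'s side of a root bridge `f = {a₁, v}` and `a₃` NOT on `v`'s side (on `a₁`'s side
or on neither), every copy of the support has the state `(f ∧ hv, L_o, f ∧ hv ∧ L_o, L_b,
f ∧ hv ∧ L_b, L₃, f ∧ hv ∧ L₃)` (`st_eq_nearSt`) and the `S₃`-symmetrisation of the kernel vanishes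
pointwise (`KBsym_nearSt`, `decide`): the typed base is `0` (`typedCount_eq_zero_of_rootBridge_near`).
Together with Part III this is **row 2′TRI on the root-bridge same-side class for every placement
of `a₃`** (`typedCount_nonneg_of_rootBridge_sameSide`, and its `z ≡ false` form
`typedCount_nonneg_of_hasRootBridgeSameSide'` with the predicate `HasRootBridgeSameSide'` carrying
no hypothesis on `a₃`).  The placements with `o` or `b` on neither side are night-3's
`typedCount_eq_zero_of_oFree / _bFree` (TypedSeparatedZero, no bridge structure needed); the placements with `o` and `b` on DIFFERENT sides of the bridge vanish only after
the factorisation (exact symbolic tables, `P3-BRIDGE.md` §2) and are not in this file.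
Own work; standard axioms.
-/

namespace Summit.Ventures.PercRepro2

open UnionCluster

namespace CovForm

namespace RootBridge

open OneTyped TypedA3 Untouched TypedFactor Separated OneEdge

/-! ## The near states and the symmetrised kernel -/

section NearStates

/-- The state of a copy with `o, b, a₃` on `a₁`'s side of the bridge (or `a₃` on neither side):
bridge bit `f`, `hv = a₂ ↔ v`, `l`-data `Lo, Lb, L3`. -/
def nearSt (f hv Lo Lb L3 : Bool) : St :=
  (f && hv, Lo, f && hv && Lo, Lb, f && hv && Lb, L3, f && hv && L3)

/-- **The symmetrised kernel vanishes on near states** (admissible bridge patterns; a copy with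
the bridge open and `v ↔ a₂` fails `Q`, the others have the constant `H`-part `(0, 0, 0)`). -/
theorem KBsym_nearSt (fx hvx Lox Lbx L3x fy hvy Loy Lby L3y fw hvw Low Lbw L3w : Bool)
    (hadm : Adm fx fy fw) :
    KB (nearSt fx hvx Lox Lbx L3x) (nearSt fy hvy Loy Lby L3y) (nearSt fw hvw Low Lbw L3w) +
      KB (nearSt fx hvx Lox Lbx L3x) (nearSt fw hvw Low Lbw L3w) (nearSt fy hvy Loy Lby L3y) +
      KB (nearSt fy hvy Loy Lby L3y) (nearSt fx hvx Lox Lbx L3x) (nearSt fw hvw Low Lbw L3w) +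
      KB (nearSt fy hvy Loy Lby L3y) (nearSt fw hvw Low Lbw L3w) (nearSt fx hvx Lox Lbx L3x) +
      KB (nearSt fw hvw Low Lbw L3w) (nearSt fx hvx Lox Lbx L3x) (nearSt fy hvy Loy Lby L3y) +
      KB (nearSt fw hvw Low Lbw L3w) (nearSt fy hvy Loy Lby L3y) (nearSt fx hvx Lox Lbx L3x) = 0 := by
  revert fx hvx Lox Lbx L3x fy hvy Loy Lby L3y fw hvw Low Lbw L3w
  decide +kernel

end NearStates

/-! ## The support -/

section Support

open Classical

variable {V : Type*} {E : Type*} [Fintype E] [DecidableEq E]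
variable (ends : E → Sym2 V) (o a₁ a₂ a₃ b v : V) (f : E)

omit [Fintype E] in
/-- **The state of a copy of the support with `o, b` on `a₁`'s side and `a₃` not on `v`'s side.** -/
theorem st_eq_nearSt {F : Finset E} {z : Config E} (hzf : z f = false) (hf : f ∈ F)
    (hends : ends f = s(a₁, v)) (hsep : Sep ends a₁ a₂ (F.erase f) z)
    (hv : v ∈ cluster ends (zF (F.erase f) z) a₂) (ho : o ∈ cluster ends (zF (F.erase f) z) a₁)
    (hb : b ∈ cluster ends (zF (F.erase f) z) a₁) (h3 : a₃ ∉ cluster ends (zF (F.erase f) z) a₂)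
    {x : Config E} (hx : ∀ e, e ∉ F → x e = z e) :
    st ends o a₁ a₂ a₃ b x =
      nearSt (x f) (decide (Conn ends (Function.update x f false) a₂ v))
        (decide (Conn ends (Function.update x f false) a₁ o))
        (decide (Conn ends (Function.update x f false) a₁ b))
        (decide (Conn ends (Function.update x f false) a₁ a₃)) := by
  set xf := Function.update x f false with hxf
  have hzz : Function.update z f false = z := Function.update_eq_self_iff.2 hzf.symm
  have hxf' : ∀ e, e ∉ F.erase f → xf e = z e := by
    have := closed_on_support f hx hf
    rwa [hzz] at this
  have hle : xf ≤ zF (F.erase f) z := le_zF hxf'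
  rw [mem_cluster] at hv ho hb h3
  have hq : ¬ Conn ends xf a₂ a₁ := fun h => hsep (conn_mono hle h)
  have hH3 : ¬ Conn ends xf a₂ a₃ := fun h => h3 (conn_mono hle h)
  have hHo : ¬ Conn ends xf a₂ o := fun h => hsep (conn_trans (conn_mono hle h) (conn_symm ho))
  have hHb : ¬ Conn ends xf a₂ b := fun h => hsep (conn_trans (conn_mono hle h) (conn_symm hb))
  have ha1v : ¬ Conn ends xf a₁ v := fun h => hsep (conn_trans hv (conn_symm (conn_mono hle h)))
  have hvo : ¬ Conn ends xf v o := fun h =>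
    hsep (conn_trans hv (conn_trans (conn_mono hle h) (conn_symm ho)))
  have hvb : ¬ Conn ends xf v b := fun h =>
    hsep (conn_trans hv (conn_trans (conn_mono hle h) (conn_symm hb)))
  have hv3 : ¬ Conn ends xf v a₃ := fun h => h3 (conn_trans hv (conn_mono hle h))
  unfold st nearSt
  cases hxfb : x f
  · have hxx : x = xf := by rw [hxf, ← hxfb, Function.update_eq_self]
    rw [hxx]
    simp only [Bool.false_and, hq, hHo, hHb, hH3, decide_false]
  · have hxx : x = Function.update xf f true := by
      rw [hxf, Function.update_idem, ← hxfb, Function.update_eq_self]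
    have key := fun s t => conn_update_true_iff hends xf s t
    rw [hxx]
    simp only [Bool.true_and]
    have e1 : Conn ends (Function.update xf f true) a₂ a₁ ↔ Conn ends xf a₂ v := by
      rw [key]; constructor
      · rintro (h | ⟨h, _⟩ | ⟨h, _⟩)
        · exact absurd h hq
        · exact absurd h hq
        · exact h
      · intro h; exact Or.inr (Or.inr ⟨h, conn_refl _ _ _⟩)
    have e2 : Conn ends (Function.update xf f true) a₁ o ↔ Conn ends xf a₁ o := by
      rw [key]; constructor
      · rintro (h | ⟨_, h⟩ | ⟨h, _⟩)
        · exact h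
        · exact absurd h hvo
        · exact absurd h ha1v
      · intro h; exact Or.inl h
    have e3 : Conn ends (Function.update xf f true) a₂ o ↔ Conn ends xf a₂ v ∧ Conn ends xf a₁ o := by
      rw [key]; constructor
      · rintro (h | ⟨h, _⟩ | ⟨h1, h2⟩)
        · exact absurd h hHo
        · exact absurd h hq
        · exact ⟨h1, h2⟩
      · rintro ⟨h1, h2⟩; exact Or.inr (Or.inr ⟨h1, h2⟩)
    have e4 : Conn ends (Function.update xf f true) a₁ b ↔ Conn ends xf a₁ b := by
      rw [key]; constructor
      · rintro (h | ⟨_, h⟩ | ⟨h, _⟩)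
        · exact h
        · exact absurd h hvb
        · exact absurd h ha1v
      · intro h; exact Or.inl h
    have e5 : Conn ends (Function.update xf f true) a₂ b ↔ Conn ends xf a₂ v ∧ Conn ends xf a₁ b := by
      rw [key]; constructor
      · rintro (h | ⟨h, _⟩ | ⟨h1, h2⟩)
        · exact absurd h hHb
        · exact absurd h hq
        · exact ⟨h1, h2⟩
      · rintro ⟨h1, h2⟩; exact Or.inr (Or.inr ⟨h1, h2⟩)
    have e6 : Conn ends (Function.update xf f true) a₁ a₃ ↔ Conn ends xf a₁ a₃ := by
      rw [key]; constructor
      · rintro (h | ⟨_, h⟩ | ⟨h, _⟩)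
        · exact h
        · exact absurd h hv3
        · exact absurd h ha1v
      · intro h; exact Or.inl h
    have e7 : Conn ends (Function.update xf f true) a₂ a₃ ↔ Conn ends xf a₂ v ∧ Conn ends xf a₁ a₃ := by
      rw [key]; constructor
      · rintro (h | ⟨h, _⟩ | ⟨h1, h2⟩)
        · exact absurd h hH3
        · exact absurd h hq
        · exact ⟨h1, h2⟩
      · rintro ⟨h1, h2⟩; exact Or.inr (Or.inr ⟨h1, h2⟩)
    rw [decide_eq_decide.mpr e1, decide_eq_decide.mpr e2, decide_eq_decide.mpr e3,
      decide_eq_decide.mpr e4, decide_eq_decide.mpr e5, decide_eq_decide.mpr e6,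
      decide_eq_decide.mpr e7]
    · simp only [Bool.decide_and]
    all_goals infer_instance

end Support

/-! ## The theorems -/

section Main

open Classical

variable {V : Type*} {E : Type*} [Fintype E] [DecidableEq E] {R : Type*} [Field R]
  [LinearOrder R] [IsStrictOrderedRing R]
variable (ends : E → Sym2 V) (o a₁ a₂ a₃ b v : V) (f : E)

/-- **The typed base vanishes** with `o, b` on `a₁`'s side of the bridge and `a₃` not on `v`'s
side: six times it is the count of the symmetrised kernel, which vanishes on the support. -/
theorem typedCount_eq_zero_of_rootBridge_near (F : Finset E) (z : Config E) (τ : E → ℕ)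
    (hτ : ∀ e ∈ F, τ e = 1 ∨ τ e = 2) (hzf : z f = false) (hf : f ∈ F)
    (hends : ends f = s(a₁, v)) (hsep : Sep ends a₁ a₂ (F.erase f) z)
    (hv : v ∈ cluster ends (zF (F.erase f) z) a₂) (ho : o ∈ cluster ends (zF (F.erase f) z) a₁)
    (hb : b ∈ cluster ends (zF (F.erase f) z) a₁) (h3 : a₃ ∉ cluster ends (zF (F.erase f) z) a₂) :
    typedCount F z τ (K3 ends o a₁ a₂ a₃ b : Config E → Config E → Config E → R) = 0 := by
  have h6 := six_mul_typedCount F z τ hτ (K3 ends o a₁ a₂ a₃ b : Config E → Config E → Config E → R)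
  have hzero : typedCount F z τ (fun x y w => (K3 ends o a₁ a₂ a₃ b x y w : R) +
      K3 ends o a₁ a₂ a₃ b x w y + K3 ends o a₁ a₂ a₃ b y x w + K3 ends o a₁ a₂ a₃ b y w x +
      K3 ends o a₁ a₂ a₃ b w x y + K3 ends o a₁ a₂ a₃ b w y x) =
      typedCount F z τ (fun _ _ _ => (0 : R)) := by
    refine typedCount_congr_on_support F z τ fun x y w hc hopen => ?_
    have hadm : Adm (x f) (y f) (w f) := by
      have := hopen f hf
      unfold openCount at this
      unfold Adm
      rcases hτ f hf with h | h <;> omega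
    have hsx := st_eq_nearSt ends o a₁ a₂ a₃ b v f hzf hf hends hsep hv ho hb h3
      (fun e he => (hc e he).1)
    have hsy := st_eq_nearSt ends o a₁ a₂ a₃ b v f hzf hf hends hsep hv ho hb h3
      (fun e he => (hc e he).2.1)
    have hsw := st_eq_nearSt ends o a₁ a₂ a₃ b v f hzf hf hends hsep hv ho hb h3
      (fun e he => (hc e he).2.2)
    simp only [K3_eq_KB, hsx, hsy, hsw]
    exact_mod_cast KBsym_nearSt _ _ _ _ _ _ _ _ _ _ _ _ _ _ _ hadm
  have : (6 : R) * typedCount F z τ (K3 ends o a₁ a₂ a₃ b : Config E → Config E → Config E → R) = 0 := by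
    rw [h6, hzero, typedCount_zero_kernel]
  exact (mul_eq_zero.1 this).resolve_left (by norm_num)

/-- **Row 2′TRI on the root-bridge same-side class, every placement of `a₃`**: `o, b` on `a₁`'s
side of the bridge `f = {a₁, v}`, `v` beyond it. -/
theorem typedCount_nonneg_of_rootBridge_sameSide (F : Finset E) (z : Config E) (τ : E → ℕ)
    (hτ : ∀ e ∈ F, τ e = 1 ∨ τ e = 2) (hzf : z f = false) (hf : f ∈ F)
    (hends : ends f = s(a₁, v)) (hsep : Sep ends a₁ a₂ (F.erase f) z)
    (hv : v ∈ cluster ends (zF (F.erase f) z) a₂) (ho : o ∈ cluster ends (zF (F.erase f) z) a₁)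
    (hb : b ∈ cluster ends (zF (F.erase f) z) a₁) :
    0 ≤ typedCount F z τ (K3 ends o a₁ a₂ a₃ b : Config E → Config E → Config E → R) := by
  by_cases h3 : a₃ ∈ cluster ends (zF (F.erase f) z) a₂
  · exact typedCount_nonneg_of_rootBridge ends o a₁ a₂ a₃ b v f F z τ hτ hzf hf hends hsep hv ho hb h3
  · rw [typedCount_eq_zero_of_rootBridge_near ends o a₁ a₂ a₃ b v f F z τ hτ hzf hf hends hsep hv
      ho hb h3]

/-- **The root-bridge same-side class** of the typed graph `(V, F)`, with no hypothesis on `a₃`: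
a typed edge `f = {a₁, v}` whose removal separates the roots, `v` on `a₂`'s side, `o, b` on
`a₁`'s side. -/
def HasRootBridgeSameSide' (F : Finset E) : Prop :=
  ∃ f ∈ F, ∃ v : V, ends f = s(a₁, v) ∧ ¬ Conn ends (typedConf (F.erase f)) a₂ a₁ ∧
    v ∈ cluster ends (typedConf (F.erase f)) a₂ ∧ o ∈ cluster ends (typedConf (F.erase f)) a₁ ∧
    b ∈ cluster ends (typedConf (F.erase f)) a₁

/-- **Row 2′TRI on the root-bridge same-side class at `z ≡ false`, every placement of `a₃`** — the
conjunct `¬ HasRootBridgeSameSide'` subtracts this class from the residual domain of S4. -/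
theorem typedCount_nonneg_of_hasRootBridgeSameSide' (F : Finset E) (τ : E → ℕ)
    (hτ : ∀ e ∈ F, τ e = 1 ∨ τ e = 2) (h : HasRootBridgeSameSide' ends o a₁ a₂ b F) :
    0 ≤ typedCount F (fun _ => false) τ (K3 ends o a₁ a₂ a₃ b : Config E → Config E → Config E → R) := by
  obtain ⟨f, hf, v, hends, hsep, hv, ho, hb⟩ := h
  rw [← zF_false'] at hsep hv ho hb
  exact typedCount_nonneg_of_rootBridge_sameSide ends o a₁ a₂ a₃ b v f F _ τ hτ rfl hf hends hsep hv
    ho hb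

end Main

end RootBridge

end CovForm

end Summit.Ventures.PercRepro2
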